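import Literature.AlgebraicGeometry.Motives.ComplexPointsEhresmann
import Literature.AlgebraicGeometry.Motives.UniversalHypersurfaceFibre
import Literature.AlgebraicGeometry.HodgeTheory.HyperplaneSectionMonodromyTrivialisations
import Literature.AlgebraicGeometry.HodgeTheory.UniversalHypersurfaceLocalSystem
import HarnessLib

/-!
# Ehresmann's theorem for the universal family of smooth hypersurfaces; `Rᵏ π_* ℂ` on `U(ℂ)`

Family `hodge`, layer `Literature/AlgebraicGeometry/HodgeTheory`. For the universal family
`π = Motives.UniversalHypersurface.family ℂ n d : 𝒴_U → U` of smooth hypersurfaces of degree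
`d ≥ 1` in `ℙⁿ⁺¹_ℂ` (`Motives/UniversalHypersurfaceFamily`; Voisin, *Hodge Theory II*, §6.2.1 "the
universal smooth hypersurface `π : 𝒴 → B`") this file PROVES the topological input of the local
systems `Rᵏ π_* ℂ` on the whole parameter space `U(ℂ)` — the hypothesis
`IsCohomologicallyLocallyTrivialOn π Set.univ` under which `HodgeTheory/UniversalHypersurfaceLocalSystem`
constructed `universalHypersurfaceLocalSystem n d k hU` — from the tree's PROVED Ehresmann theorem on
complex points (`Motives/ComplexPointsEhresmann`, landed 2026-08-15):

* scheme-theoretic bookkeeping for the universal family over any field `k`: the base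
  `U ⊆ S^d = Spec k[a_m]` is quasi-compact (an open of a Noetherian scheme), smooth over `k` of
  relative dimension `#{monomials}`, separated and of finite type; the total space `𝒴_U` is
  quasi-compact, separated and of finite type over `k`; `π` is proper
  (`compactSpace_base_left`, `smoothOfRelativeDimension_base_hom`, `isSeparated_base_hom`,
  `locallyOfFiniteType_base_hom`, `compactSpace_total_left`, `isSeparated_total_hom`,
  `locallyOfFiniteType_total_hom`, `isProper_family_left`); hence `U(ℂ)` and `𝒴_U(ℂ)` are second
  countable (`secondCountableTopology_base`, `secondCountableTopology_total`, Serre GAGA §2 via the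
  tree's `ComplexPoints.secondCountableTopology_of_compactSpace_holds`);
* `isLocallyTrivialFibration_map_family` — **Ehresmann for the universal smooth hypersurface**:
  `π(ℂ) : 𝒴_U(ℂ) → U(ℂ)` is a locally trivial fibration (Voisin I, Thm. 9.3 for the proper
  holomorphic submersion `π(ℂ)`; the tree's
  `ComplexPoints.isLocallyTrivialFibration_map_of_smoothOfRelativeDimension`, i.e. Bröcker–Jänich
  (8.12) for the proper submersion of real `C^∞` manifolds `𝒴_U(ℂ) → U(ℂ)`);
* `isHomotopicallyLocallyTrivialOn_family`, `isCohomologicallyLocallyTrivialOn_family` — over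
  small balls `B` of `U(ℂ)` every fibre inclusion `Y_s(ℂ) ↪ π⁻¹B(ℂ)` is a homotopy equivalence,
  so restriction `Hʲ(π⁻¹B(ℂ); ℂ) → Hʲ(Y_s(ℂ); ℂ)` is bijective (Voisin I, §9.2.1: "as `B` is locally
  contractible, we have `Hᵏ(X₀ × B₀, A) ≅ Hᵏ(X₀, A)`"): **the hypothesis `hU` of
  `universalHypersurfaceLocalSystem` holds unconditionally**, whence the local system
  `universalHypersurfaceLocalSystemOfEhresmann n d k : Motives.LocalSystem ℂ U(ℂ)` with stalks
  `Hᵏ(Y_s(ℂ); ℂ)` and all the API of that file (`universalHypersurfaceLocalSystem_*`);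
* `smoothFiberLocus_family` — every fibre is a smooth projective `n`-fold (`n, d ≥ 1`;
  `Motives.UniversalHypersurface.isSmoothProjectiveFamily_family`), so the smooth-fibre locus of
  `HodgeTheory/HyperplaneSectionLocalSystem` is all of `U(ℂ)`, and
  `directImageLocalSystemFamily n d hn hd : DirectImageLocalSystem π n` — **the monodromy package
  `Rᵏ π_* ℂ|_U` of the universal smooth hypersurface** (local systems in every degree with stalks
  `Hᵏ(Y_s(ℂ); ℂ)` by restriction, global classes flat, transport multiplicative and defined over `ℚ`;
  Voisin I §9.2.1–9.2.2, Voisin II §3.1.2), inhabited with no hypothesis left;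
* `toProjectiveSpace k n d : total k n d ⟶ projectiveSpace (n + 1) k` — the projection
  `𝒴_U ⊆ ℙⁿ⁺¹ × U → ℙⁿ⁺¹_k` (through `Proj.map` of `k[x] → k[a_m][x]`), and
  `hyperplaneSectionLocalSystemFamily n d hn hd : HyperplaneSectionLocalSystem π n (toProjectiveSpace ℂ n d)`
  — the package with, in addition, the stability under transport of the vanishing cohomology
  `Hⁿ(Y_s(ℂ); ℂ)_van = ker ((j ∘ ι_s)_* : Hⁿ(Y_s) → Hⁿ⁺²(ℙⁿ⁺¹))` ("a local subsystem `Ker J_*`",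
  Voisin II §3.2.3), again with no hypothesis left.

This is the honest, `B`-independent topological half of what the mis-stated named fact
`Motives.universalSmoothHypersurfaceVHS` asserts for every abstract Betti datum `B` (see the module
docstring of `HodgeTheory/UniversalHypersurfaceLocalSystem` for the discrepancy). Not here: the Hodge
filtration on the stalks, its polarization, the integral local system `Rᵏ π_* ℤ`.

## References

* [VoisinHodgeI2002] C. Voisin, *Hodge Theory and Complex Algebraic Geometry I*, CUP 2002, Thm. 9.3,
  Prop. 9.5, §9.2.1.
* [VoisinHodgeII2003] C. Voisin, *Hodge Theory and Complex Algebraic Geometry II*, CUP 2003, §3.1.2,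
  §6.2.1.
* [BrockerJanichIDT1982] Th. Bröcker, K. Jänich, *Introduction to Differential Topology*, CUP 1982,
  (8.12).
* [Hartshorne1977] R. Hartshorne, *Algebraic Geometry*, Springer 1977, III §10 Example 10.0.1,
  Thm. 10.2.
* [SerreGAGA1956] J.-P. Serre, *Géométrie algébrique et géométrie analytique*, Ann. Inst. Fourier 6
  (1956), §2.
-/

noncomputable section

open CategoryTheory AlgebraicGeometry TopologicalSpace
open _root_.Topology _root_.Filter
open Literature.AlgebraicTopology.SingularHomology
open Literature.AlgebraicTopology.Homotopy (IsLocallyTrivialFibration)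

namespace Literature.AlgebraicGeometry.HodgeTheory

namespace UniversalHypersurface

open Motives.UniversalHypersurface

universe u

/-! ### Scheme-theoretic bookkeeping for the universal family -/

section Scheme

variable (k : Type u) [Field k] (n d : ℕ)

/-- The coefficient space `S^d = Spec k[a_m]` (finitely many variables over a field) is a
Noetherian topological space. [folklore] -/
theorem noetherianSpace_specCoeff :
    NoetherianSpace (Spec (CommRingCat.of (CoeffRing k n d))) :=
  inferInstanceAs (NoetherianSpace (PrimeSpectrum (CoeffRing k n d)))

/-- The base `U ⊆ S^d` of the universal family is a Noetherian topological space (an open subspace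
of the Noetherian `S^d`). [folklore] -/
theorem noetherianSpace_base_left : NoetherianSpace (base k n d).left :=
  haveI := noetherianSpace_specCoeff k n d
  (baseOpens k n d).ι.isOpenEmbedding.isInducing.noetherianSpace

/-- The base `U` of the universal family is quasi-compact. [folklore] -/
theorem compactSpace_base_left : CompactSpace (base k n d).left :=
  haveI := noetherianSpace_base_left k n d
  inferInstance

/-- `S^d = Spec k[a_m] → Spec k` is smooth of relative dimension the number `#{m}` of degree-`d`
monomials (affine space; Hartshorne III §10 Example 10.0.1, through the tree's
`isStandardSmoothOfRelativeDimension_coeffRing`). [cite: Hartshorne1977, III §10 Example 10.0.1] -/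
theorem smoothOfRelativeDimension_specCoeffToSpec :
    SmoothOfRelativeDimension (Fintype.card (DegIndex n d)) (specCoeffToSpec k n d) := by
  rw [HasRingHomProperty.Spec_iff (P := @SmoothOfRelativeDimension (Fintype.card (DegIndex n d))),
    CommRingCat.hom_ofHom]
  refine RingHom.locally_of RingHom.isStandardSmoothOfRelativeDimension_respectsIso _ ?_
  rw [RingHom.isStandardSmoothOfRelativeDimension_algebraMap]
  exact isStandardSmoothOfRelativeDimension_coeffRing k n d

/-- The base `U → Spec k` is smooth of relative dimension `0 + #{m}` (open immersion into the
affine space `S^d`, then `S^d → Spec k`). [cite: Hartshorne1977, III §10 Example 10.0.1] -/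
theorem smoothOfRelativeDimension_base_hom :
    SmoothOfRelativeDimension (0 + Fintype.card (DegIndex n d)) (base k n d).hom := by
  haveI := smoothOfRelativeDimension_specCoeffToSpec k n d
  change SmoothOfRelativeDimension _ ((baseOpens k n d).ι ≫ specCoeffToSpec k n d)
  infer_instance

/-- The base `U` is separated over `k`. [folklore] -/
theorem isSeparated_base_hom : IsSeparated (base k n d).hom := by
  change IsSeparated ((baseOpens k n d).ι ≫ specCoeffToSpec k n d)
  infer_instance

/-- `S^d → Spec k` is locally of finite type (it is smooth). [folklore] -/
theorem locallyOfFiniteType_specCoeffToSpec : LocallyOfFiniteType (specCoeffToSpec k n d) :=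
  haveI := smoothOfRelativeDimension_specCoeffToSpec k n d
  haveI : Smooth (specCoeffToSpec k n d) :=
    SmoothOfRelativeDimension.smooth (Fintype.card (DegIndex n d)) _
  inferInstance

/-- The base `U` is locally of finite type over `k`. [folklore] -/
theorem locallyOfFiniteType_base_hom : LocallyOfFiniteType (base k n d).hom := by
  haveI := locallyOfFiniteType_specCoeffToSpec k n d
  change LocallyOfFiniteType ((baseOpens k n d).ι ≫ specCoeffToSpec k n d)
  infer_instance

/-- `π : 𝒴_U → U` is proper (as the underlying morphism of the `k`-morphism `family k n d`).
[folklore] -/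
theorem isProper_family_left : IsProper (family k n d).left := by
  change IsProper (familyHom k n d)
  infer_instance

/-- The total space `𝒴_U` is separated over `k` (`π` proper, `U` separated). [folklore] -/
theorem isSeparated_total_hom : IsSeparated (total k n d).hom := by
  change IsSeparated (familyHom k n d ≫ (baseOpens k n d).ι ≫ specCoeffToSpec k n d)
  infer_instance

/-- The total space `𝒴_U` is locally of finite type over `k`. [folklore] -/
theorem locallyOfFiniteType_total_hom : LocallyOfFiniteType (total k n d).hom := by
  haveI := locallyOfFiniteType_specCoeffToSpec k n d
  change LocallyOfFiniteType (familyHom k n d ≫ (baseOpens k n d).ι ≫ specCoeffToSpec k n d)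
  infer_instance

/-- The total space `𝒴_U` is quasi-compact (`π` is quasi-compact onto the quasi-compact `U`).
[folklore] -/
theorem compactSpace_total_left : CompactSpace (total k n d).left := by
  haveI : CompactSpace (baseOpens k n d : Scheme.{u}) := compactSpace_base_left k n d
  change CompactSpace ((totalToSpec k n d) ⁻¹ᵁ (baseOpens k n d) : Scheme.{u})
  exact QuasiCompact.compactSpace_of_compactSpace (familyHom k n d)

attribute [local instance] MvPolynomial.gradedAlgebra Motives.ProjBaseChange.algebraBase
  Motives.ProjBaseChange.isScalarTower_localization

/-- The base change `ℙⁿ⁺¹_R → ℙⁿ⁺¹_k`, `R = k[a_m]` the coefficient ring (Mathlib `Proj.map` of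
`k[x] → R[x]`; the cartesian square `ℙⁿ⁺¹_R = ℙⁿ⁺¹_k ×_k S^d` is the tree's
`ProjBaseChangeRing.isPullback_projMap'`). [folklore] -/
def projSpToProjSp : projSp n (CoeffRing k n d) ⟶ projSp n k :=
  Proj.map (Motives.ProjBaseChangeRing.mapGraded k (CoeffRing k n d) (Fin (n + 2)))
    (Motives.ProjBaseChangeRing.irrelevant_le_map k (CoeffRing k n d) (Fin (n + 2)))

/-- `ℙⁿ⁺¹_R → ℙⁿ⁺¹_k → Spec k` is `ℙⁿ⁺¹_R → S^d → Spec k`. [folklore] -/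
@[reassoc]
theorem projSpToProjSp_comp_projSpToSpec :
    projSpToProjSp k n d ≫ projSpToSpec n k = projSpToSpec n (CoeffRing k n d) ≫ specCoeffToSpec k n d :=
  (Motives.ProjBaseChangeRing.isPullback_projMap' k (CoeffRing k n d)).w

/-- **The projection `𝒴_U ⊆ ℙⁿ⁺¹_k × U → ℙⁿ⁺¹_k`** as a morphism of `k`-schemes (`𝒴_U ↪ 𝒴 ↪ ℙⁿ⁺¹_R →
ℙⁿ⁺¹_k`): the morphism `j` along which every fibre `Y_s` is a hypersurface of `ℙⁿ⁺¹` (Voisin II,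
§6.2.1; the `j` of the hyperplane-section packages of `HodgeTheory/HyperplaneSectionLocalSystem`).
[cite: VoisinHodgeII2003, §6.2.1] -/
def toProjectiveSpace : total k n d ⟶ Motives.projectiveSpace (n + 1) k :=
  Over.homMk (((totalToSpec k n d) ⁻¹ᵁ (baseOpens k n d)).ι ≫ totalι k n d ≫ projSpToProjSp k n d) (by
    change (((totalToSpec k n d) ⁻¹ᵁ (baseOpens k n d)).ι ≫ totalι k n d ≫ projSpToProjSp k n d) ≫
        projSpToSpec n k =
      (totalToSpec k n d ∣_ baseOpens k n d) ≫ (baseOpens k n d).ι ≫ specCoeffToSpec k n d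
    rw [morphismRestrict_ι_assoc]
    simp only [Category.assoc, projSpToProjSp_comp_projSpToSpec])

/-- The underlying scheme morphism of `toProjectiveSpace` (`rfl`). [folklore] -/
theorem toProjectiveSpace_left :
    (toProjectiveSpace k n d).left =
      ((totalToSpec k n d) ⁻¹ᵁ (baseOpens k n d)).ι ≫ totalι k n d ≫ projSpToProjSp k n d :=
  rfl

end Scheme

/-! ### Ehresmann's theorem for `π(ℂ) : 𝒴_U(ℂ) → U(ℂ)` -/

section Complex

variable (n d : ℕ)

/-- `U(ℂ)` is second countable (Serre, GAGA §2: finitely many charts). [cite: SerreGAGA1956, §2 n°5, p. 9] -/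
theorem secondCountableTopology_base :
    SecondCountableTopology (Motives.ComplexPoints (base ℂ n d)) :=
  haveI := locallyOfFiniteType_base_hom ℂ n d
  haveI := compactSpace_base_left ℂ n d
  Motives.ComplexPoints.secondCountableTopology_of_compactSpace_holds _

/-- `𝒴_U(ℂ)` is second countable (Serre, GAGA §2). [cite: SerreGAGA1956, §2 n°5, p. 9] -/
theorem secondCountableTopology_total :
    SecondCountableTopology (Motives.ComplexPoints (total ℂ n d)) :=
  haveI := locallyOfFiniteType_total_hom ℂ n d
  haveI := compactSpace_total_left ℂ n d
  Motives.ComplexPoints.secondCountableTopology_of_compactSpace_holds _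

/-- **Ehresmann's theorem for the universal smooth hypersurface** (Voisin I, Thm. 9.3, for the
proper holomorphic submersion `π(ℂ)`; Voisin II, §6.2.1): for `d ≥ 1` the map
`π(ℂ) : 𝒴_U(ℂ) → U(ℂ)` is a locally trivial fibration — every `t ∈ U(ℂ)` has an open
neighbourhood `V` with `V × π(ℂ)⁻¹(t) ≃ π(ℂ)⁻¹(V)` over `V`. The tree's Ehresmann theorem on
complex points (`ComplexPoints.isLocallyTrivialFibration_map_of_smoothOfRelativeDimension`:
`π(ℂ)` is a proper submersion of real `C^∞` manifolds, Bröcker–Jänich (8.12)) applied to the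
smooth (`smoothOfRelativeDimension_family_left`, Hartshorne III Thm. 10.2) proper family `π` over
the smooth base `U`. [cite: VoisinHodgeI2002, Thm. 9.3 (with Prop. 9.5)]
[cite: BrockerJanichIDT1982, (8.12)] -/
theorem isLocallyTrivialFibration_map_family (hd : 1 ≤ d) :
    IsLocallyTrivialFibration
      (Motives.AlgPoints.map (family ℂ n d) :
        Motives.ComplexPoints (total ℂ n d) → Motives.ComplexPoints (base ℂ n d)) := by
  haveI := smoothOfRelativeDimension_base_hom ℂ n d
  haveI := locallyOfFiniteType_base_hom ℂ n d
  haveI := isSeparated_base_hom ℂ n d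
  haveI := isSeparated_total_hom ℂ n d
  haveI := secondCountableTopology_base n d
  haveI := secondCountableTopology_total n d
  haveI := isProper_family_left ℂ n d
  haveI : SmoothOfRelativeDimension n (family ℂ n d).left :=
    smoothOfRelativeDimension_family_left ℂ n d hd
  exact Motives.ComplexPoints.isLocallyTrivialFibration_map_of_smoothOfRelativeDimension n
    (0 + Fintype.card (DegIndex n d)) (family ℂ n d)

/-- **Homotopical local triviality of the universal smooth hypersurface over all of `U(ℂ)`**: every
point of `U(ℂ)` has arbitrarily small open neighbourhoods `B` (balls in the algebraic charts of
`U(ℂ)`) over which every fibre inclusion `Y_s(ℂ) ↪ π⁻¹B(ℂ)` is a homotopy equivalence (Ehresmann's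
trivialisations over contractible `B`, Voisin I Thm. 9.3 with Rem. 9.4 and §9.2.1).
[cite: VoisinHodgeI2002, Thm. 9.3 and §9.2.1] -/
theorem isHomotopicallyLocallyTrivialOn_family (hd : 1 ≤ d) :
    IsHomotopicallyLocallyTrivialOn (family ℂ n d) Set.univ := by
  haveI := isProper_family_left ℂ n d
  haveI := isSeparated_total_hom ℂ n d
  haveI := locallyOfFiniteType_base_hom ℂ n d
  haveI := smoothOfRelativeDimension_base_hom ℂ n d
  letI := Motives.ComplexPoints.chartedSpace (base ℂ n d) (0 + Fintype.card (DegIndex n d))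
  refine isHomotopicallyLocallyTrivialOn_of_trivialisations (family ℂ n d)
    (fun t _ W hW ↦ ?_) (fun t _ ↦ ?_)
  · obtain ⟨B, hBo, htB, hBW, hBc⟩ :=
      exists_isOpen_contractibleSpace_of_chartedSpace
        (d := 2 * (0 + Fintype.card (DegIndex n d))) t W hW
    exact ⟨B, hBo, htB, hBW, hBc⟩
  · obtain ⟨V, hVo, htV, φ, hφ⟩ := isLocallyTrivialFibration_map_family n d hd t
    exact ⟨V, hVo, htV, Set.subset_univ _, _, inferInstance, φ, hφ⟩

/-- **Cohomological local triviality of the universal smooth hypersurface over `U(ℂ)`** — the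
hypothesis `hU` of `universalHypersurfaceLocalSystem` (`HodgeTheory/UniversalHypersurfaceLocalSystem`)
holds: over small open `B ⊆ U(ℂ)` restriction `Hʲ(π⁻¹B(ℂ); ℂ) → Hʲ(Y_s(ℂ); ℂ)` is bijective for all
`s ∈ B` and all `j` (Voisin I, §9.2.1: "as `B` is locally contractible, we have
`Hᵏ(X₀ × B₀, A) ≅ Hᵏ(X₀, A)`"). [cite: VoisinHodgeI2002, §9.2.1 (with Thm. 9.3)] -/
theorem isCohomologicallyLocallyTrivialOn_family (hd : 1 ≤ d) :
    IsCohomologicallyLocallyTrivialOn (family ℂ n d) Set.univ :=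
  (isHomotopicallyLocallyTrivialOn_family n d hd).isCohomologicallyLocallyTrivialOn

/-- **The local system `Rᵏ π_* ℂ` of the universal smooth hypersurface on `U(ℂ)`, unconditionally**:
`universalHypersurfaceLocalSystem n d k hU` of `HodgeTheory/UniversalHypersurfaceLocalSystem` with its
hypothesis `hU` discharged by Ehresmann's theorem (`isCohomologicallyLocallyTrivialOn_family`). Its
stalk at `s` is `Hᵏ(Y_s(ℂ); ℂ)` on the nose and all the `universalHypersurfaceLocalSystem_*` API
applies (global classes are flat sections, the stalks are the cohomology of the fibres by
restriction, transport is multiplicative). [cite: VoisinHodgeI2002, §9.2.1 (with Thm. 9.3)]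
[cite: VoisinHodgeII2003, §6.2.1] -/
def universalHypersurfaceLocalSystemOfEhresmann (k : ℕ) (hd : 1 ≤ d) :
    Motives.LocalSystem ℂ (universalHypersurfaceBasePoints n d) :=
  universalHypersurfaceLocalSystem n d k (isCohomologicallyLocallyTrivialOn_family n d hd)

/-- The stalk of `Rᵏ π_* ℂ` at `s` is `Hᵏ(Y_s(ℂ); ℂ)` (`rfl`). [cite: VoisinHodgeI2002, §9.2.1] -/
theorem universalHypersurfaceLocalSystemOfEhresmann_fiber (k : ℕ) (hd : 1 ≤ d)
    (s : universalHypersurfaceBasePoints n d) :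
    (universalHypersurfaceLocalSystemOfEhresmann n d k hd).fiber s =
      complexBetti (Motives.fiberOver (family ℂ n d) s) k :=
  rfl

/-- **Global classes are flat sections of `Rᵏ π_* ℂ`** (unconditional form of
`universalHypersurfaceLocalSystem_transport_map_fiberι`): transport along any path of `U(ℂ)` carries
`A|_{Y_s}` to `A|_{Y_t}` for `A ∈ Hᵏ(𝒴_U(ℂ); ℂ)`. [cite: VoisinHodgeII2003, §3.1.2] -/
theorem universalHypersurfaceLocalSystemOfEhresmann_transport_map_fiberι (k : ℕ) (hd : 1 ≤ d)
    {s t : universalHypersurfaceBasePoints n d} (γ : Path.Homotopic.Quotient s t)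
    (A : complexBetti (total ℂ n d) k) :
    (universalHypersurfaceLocalSystemOfEhresmann n d k hd).transport γ
        (complexBetti.map (Motives.fiberι (family ℂ n d) s) k A) =
      complexBetti.map (Motives.fiberι (family ℂ n d) t) k A :=
  universalHypersurfaceLocalSystem_transport_map_fiberι _ γ A

/-! ### The monodromy package on the smooth-fibre locus `U(ℂ)` -/

/-- For `n, d ≥ 1` every fibre of the universal family over a complex point is a smooth projective
`n`-fold (`Motives.UniversalHypersurface.isSmoothProjectiveFamily_family`): the smooth-fibre locus of
`π` is all of `U(ℂ)`. [cite: VoisinHodgeII2003, §6.2.1] -/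
theorem smoothFiberLocus_family (hn : 1 ≤ n) (hd : 1 ≤ d) :
    smoothFiberLocus (family ℂ n d) n = Set.univ :=
  Set.eq_univ_of_forall fun s ↦
    (Motives.UniversalHypersurface.isSmoothProjectiveFamily_family ℂ hn hd).isSmoothProjective s

/-- Homotopical local triviality of the universal family over its smooth-fibre locus (`= U(ℂ)`).
[cite: VoisinHodgeI2002, Thm. 9.3 and §9.2.1] -/
theorem isHomotopicallyLocallyTrivialOn_smoothFiberLocus_family (hn : 1 ≤ n) (hd : 1 ≤ d) :
    IsHomotopicallyLocallyTrivialOn (family ℂ n d) (smoothFiberLocus (family ℂ n d) n) := by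
  rw [smoothFiberLocus_family n d hn hd]
  exact isHomotopicallyLocallyTrivialOn_family n d hd

/-- Cohomological local triviality of the universal family over its smooth-fibre locus (`= U(ℂ)`).
[cite: VoisinHodgeI2002, §9.2.1] -/
theorem isCohomologicallyLocallyTrivialOn_smoothFiberLocus_family (hn : 1 ≤ n) (hd : 1 ≤ d) :
    IsCohomologicallyLocallyTrivialOn (family ℂ n d) (smoothFiberLocus (family ℂ n d) n) :=
  (isHomotopicallyLocallyTrivialOn_smoothFiberLocus_family n d hn hd).isCohomologicallyLocallyTrivialOn

/-- **The monodromy package `Rᵏ π_* ℂ|_U` of the universal smooth hypersurface** (`n, d ≥ 1`): the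
interface `DirectImageLocalSystem π n` of `HodgeTheory/HyperplaneSectionLocalSystem` — local systems
`Rᵏ π_* ℂ` on `U(ℂ)` in every degree with stalks `Hᵏ(Y_s(ℂ); ℂ)` (here on the nose), global classes
flat, stalks identified with the cohomology of the fibres BY RESTRICTION over small opens
(Voisin I §9.2.2), transport multiplicative for the cup product and defined over `ℚ` (it is induced by
homeomorphisms of the fibres, Voisin II §3.1.2) — inhabited, with no hypothesis left, by the monodromy
of the espaces étalés (`directImageLocalSystemOfRestrict`) over Ehresmann's trivialisations
(`isHomotopicallyLocallyTrivialOn_family`; rational descent along the homotopy inverses,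
`isRationalClass_of_homotopyEquiv`). [cite: VoisinHodgeI2002, Thm. 9.3, §9.2.1–9.2.2]
[cite: VoisinHodgeII2003, §3.1.2 and §6.2.1] -/
def directImageLocalSystemFamily (hn : 1 ≤ n) (hd : 1 ≤ d) : DirectImageLocalSystem (family ℂ n d) n :=
  directImageLocalSystemOfRestrict (family ℂ n d) n
    (isCohomologicallyLocallyTrivialOn_smoothFiberLocus_family n d hn hd)
    (fun t ht ↦ by
      obtain ⟨B, hBo, htB, -, hBU, he⟩ :=
        (isHomotopicallyLocallyTrivialOn_smoothFiberLocus_family n d hn hd).exists_nhds_homotopyEquiv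
          ht Set.univ univ_mem
      refine ⟨B, hBo, htB, hBU, fun j s hs ↦ ?_, fun j s hs ξ hξ ↦ ?_⟩
      · obtain ⟨e, he⟩ := he hs
        exact (IsSpecialisingNhd.of_homotopyEquiv hBo hs e he j).bijective
      · obtain ⟨e, he⟩ := he hs
        exact isRationalClass_of_homotopyEquiv (family ℂ n d) hs e he ξ hξ)

/-- The stalks of the package are `Hᵏ(Y_s(ℂ); ℂ)` on the nose: `fiberIso` is the identity.
[folklore] -/
@[simp]
theorem directImageLocalSystemFamily_fiberIso_apply (hn : 1 ≤ n) (hd : 1 ≤ d) (k : ℕ)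
    (s : smoothFiberLocus (family ℂ n d) n) (x : complexBetti (Motives.fiberOver (family ℂ n d) s.1) k) :
    (directImageLocalSystemFamily n d hn hd).fiberIso k s x = x :=
  rfl

/-- The real-carrier transport of the package is the transport `transportFun` of the espace étalé
of `Rᵏ π_* ℂ` (`HodgeTheory/DirectImageTransport`). [folklore] -/
theorem directImageLocalSystemFamily_transportBetti (hn : 1 ≤ n) (hd : 1 ≤ d) (k : ℕ)
    {s t : smoothFiberLocus (family ℂ n d) n} (γ : Path.Homotopic.Quotient s t)
    (x : complexBetti (Motives.fiberOver (family ℂ n d) s.1) k) :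
    (directImageLocalSystemFamily n d hn hd).transportBetti k γ x =
      transportFun (family ℂ n d) k
        (isCohomologicallyLocallyTrivialOn_smoothFiberLocus_family n d hn hd) γ x :=
  rfl

/-- **Existence of the monodromy package for the universal smooth hypersurface** (`n, d ≥ 1`).
[cite: VoisinHodgeI2002, Thm. 9.3 and §9.2.1] [cite: VoisinHodgeII2003, §6.2.1] -/
theorem nonempty_directImageLocalSystem_family (hn : 1 ≤ n) (hd : 1 ≤ d) :
    Nonempty (DirectImageLocalSystem (family ℂ n d) n) :=
  ⟨directImageLocalSystemFamily n d hn hd⟩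

/-- **The hyperplane-section package of the universal smooth hypersurface** relative to
`j : 𝒴_U → ℙⁿ⁺¹_ℂ` (`toProjectiveSpace`): the monodromy package together with the stability of the
vanishing cohomology `Hⁿ(Y_s(ℂ); ℂ)_van = ker ((j ∘ ι_s)_* : Hⁿ(Y_s) → Hⁿ⁺²(ℙⁿ⁺¹))` under transport
("a local subsystem `Ker J_*`", Voisin II §3.2.3; for a hypersurface of `ℙⁿ⁺¹` this is the
variable = primitive cohomology of §2.3.3), inhabited with no hypothesis left through
`hyperplaneSectionLocalSystemOfHomotopyEquiv` (proportionality of the fundamental classes of the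
fibres of a tube) over Ehresmann's trivialisations. [cite: VoisinHodgeII2003, §3.2.3 and §6.2.1]
[cite: VoisinHodgeI2002, Thm. 9.3 and §9.2.1] -/
def hyperplaneSectionLocalSystemFamily (hn : 1 ≤ n) (hd : 1 ≤ d) :
    HyperplaneSectionLocalSystem (family ℂ n d) n (toProjectiveSpace ℂ n d) :=
  hyperplaneSectionLocalSystemOfHomotopyEquiv (family ℂ n d) (toProjectiveSpace ℂ n d) n
    (isHomotopicallyLocallyTrivialOn_smoothFiberLocus_family n d hn hd)

/-- The hyperplane-section package extends the monodromy package `directImageLocalSystemFamily`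
(`rfl`). [folklore] -/
theorem hyperplaneSectionLocalSystemFamily_toDirectImageLocalSystem (hn : 1 ≤ n) (hd : 1 ≤ d) :
    (hyperplaneSectionLocalSystemFamily n d hn hd).toDirectImageLocalSystem =
      directImageLocalSystemFamily n d hn hd :=
  rfl

/-- **Existence of the hyperplane-section package for the universal smooth hypersurface**
(`n, d ≥ 1`). [cite: VoisinHodgeII2003, §3.2.3 and §6.2.1] -/
theorem nonempty_hyperplaneSectionLocalSystem_family (hn : 1 ≤ n) (hd : 1 ≤ d) :
    Nonempty (HyperplaneSectionLocalSystem (family ℂ n d) n (toProjectiveSpace ℂ n d)) :=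
  ⟨hyperplaneSectionLocalSystemFamily n d hn hd⟩

end Complex

end UniversalHypersurface

end Literature.AlgebraicGeometry.HodgeTheory

end
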